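/-
Copyright (c) 2026 the pub-hodgecm-mathlib formalisation cell (harness21).  Prover seat hodgecm-mathlib-LH4-p08 (g7), req620 Track A «(D-RAM) FOUR-FRAME» squad, helper lane
on h413 = stmt-HodgeConjecture-24833 (count-neutral).  STAGE-1b typed inventory (heir LEAD F0P3a-plan (g20) T19-24): row (3), the κ-sum of a GENERIC piece on the Levi stratum.
2026-09-04.
-/
import Literature.NumberTheory.Rogawski1990.LocalDeltaTransferLeviStratum                 -- ★ S3-A (F0P3b-p01 (g7)): `finsum_delta_mul_classOrbitalIntegral_eq_of_unique`, `isLocalNormPair_cmDatumLocalCongr_endoEmbLocal`; brings ★ Levi-stratum kit (`isConj_of_isLocalNormPair_of_isLocalNormPair_of_levi`, `isUnit_vecCons_sub_of_levi`, `endoEmbLocal_eq_glDiagonal_of_fst_eq`, `endoEmbLocal_mem_torusU_of_endoEmbLocal_eq`)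
import Literature.NumberTheory.Automorphic.UnitaryGroupTorusOrbitalIntegralCanonicalPiece     -- ★ p858772 (this seat): `classOrbitalIntegral_mul_integral_eq_of_conj_invariant_of_left_invariant` (the division-free ratio at a regular split-torus class)
import HarnessLib

/-!
# The `Δ`-weighted class sum of a GENERIC `Ad K`-invariant piece on the LEVI stratum is proportional to that of any other such piece, in the ratio of their
# unipotent-fibre volumes — division-free: `(Σᶠ_c Δ(γ_H, c)·Φ(c, φ)) · ∫_N φ′∘e = (Σᶠ_c Δ(γ_H, c)·Φ(c, φ′)) · ∫_N φ∘e`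
(Rogawski (1990), §4.9 p. 55 «if `γ ∈ M` … the `κ`-orbital integral is the ordinary orbital integral», Prop. 4.9.1 (b) p. 55, Lemma 4.9.2 p. 56; §4.3 (4.3.1); §3.5 Prop. 3.5.2 pp. 25–26; Kottwitz (1986) §7)

Topic `NumberTheory/Rogawski1990`; namespace `Literature.NumberTheory.Rogawski1990`.  THEOREMS ONLY (no definition, no instance, no notation, no named fact, no `sorry`).
Cell `pub/hodgecm-mathlib`, crux H413 = `stmt-HodgeConjecture-24833`, Track A «(D-RAM) FOUR-FRAME», STAGE-1b typed inventory (heir LEAD F0P3a-plan (g20) T19-24 «pre-scoping by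
idle hands: allowed»; dealer LH4-plan (g12) board), seat LH4-p08 (g7).  HONEST LABEL: HC_CM is proved only modulo the 7 printed citations (2 remaining named inputs: hLiu418 =
`stmt-HodgeConjecture-24832`, h413 = `stmt-HodgeConjecture-24833`) until rung 0 closes; this file proves no letter and pays no registered stub.

THE POINT.  ROW (3) of the tier-0 row predicate `PieceRowsWild gsel j` (★ DEFS №3) reads, near `1 ∈ H_v` on the LEVI population (`γ_H` `H_v`-conjugate to a diagonal
`(diag(d′₀, d′₁), u)`), `Σᶠ_c Δ‴_v[μ](γ_H, out c) · Φ(c, gsel j) = Σ_s a_s · Φ^st(γ_H, ψ_s)`.  On that stratum the `G`-side has ONE term (★ S3-A: every norm pair of `γ_H` is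
`G_v`-conjugate to the frame's `γ₀ = e(ι_v γ_H)`, `𝔇(T∕F) = 1`), and at `γ₀` — the class of a REGULAR SPLIT-TORUS element `t = ι_v γ_H = diag(d′₀, u, d′₁)` — ★ p858772 computes the
canonical orbital integral of every `Ad K`-invariant, `t`-left-invariant Borel `φ` as the SAME constant times its unipotent-fibre volume `∫_N φ(e n) dμ_N`.  Hence for two such
functions the `Δ`-weighted class sums are proportional in the ratio of the fibre volumes — for ANY local transfer factor `T` and ANY canonical family, with no law and no `H`-side:
this is the `G`-side of row (3) for every STAGE-1b piece (`φ′ := 1_K`, the anchor, whose row (3) is ★ p855650 ∕ ★ `stableOrbitalIntegralRel_indicator_eq_finsum_delta_of_levi_antidiagOne`).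
The left-invariance hypotheses refer to `t = ι_v γ_H`; for the pieces of the four-frame line (`Ad K`-invariant and left-`K(ϖ_w^{m*})`-invariant, ★ U4 `piecePropsWild_*`) they hold as
soon as `ι_v γ_H ∈ K(ϖ_w^{m*})`, i.e. on a neighbourhood of `1` (the row's `∃ V ∈ 𝓝 1`).

* `finsum_delta_mul_classOrbitalIntegral_mul_integral_eq_of_levi` — at the diagonal representative `γ_H = (diag(d′₀, d′₁), u)` itself (Levi-regular: `d′₀⁻¹u − 1`, `d′₀⁻¹d′₁ − 1`,
  `u − d′₁` units — no `G`-regularity binder needed), frame `e = cmDatumLocalCongr L v T₀ ha₀ h` at ANY non-split place and ANY hermitian `H′` congruent to `a • Φ₃`: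
  `(Σᶠ_c T.Δ γ_H (out c) · Φ(c, φ)) · ∫_N φ′(e n) dμ_N = (Σᶠ_c T.Δ γ_H (out c) · Φ(c, φ′)) · ∫_N φ(e n) dμ_N`.
(The conjugation `γ_H ↦ yγ_Hy⁻¹` to reach a general Levi `γ_H` is carried by the consumer exactly as in ★ p855650 §2–§3: `Δ` and `Φ^st` are class functions in `γ_H`.)

## References
* [Rogawski1990] J. D. Rogawski, *Automorphic Representations of Unitary Groups in Three Variables*, Ann. of Math. Stud. 123 (1990): §4.9 Prop. 4.9.1 (b)
  p. 55, (4.9.2) and Lemma 4.9.2 p. 56; §4.3 (4.3.1) p. 43; §3.5 Prop. 3.5.2 pp. 25–26; §4.13 Lemma 4.13.1 (a) p. 64.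
* [Kottwitz1986] R. E. Kottwitz, *Base change for unit elements of Hecke algebras*, Compositio Math. 60 (1986): §7.
-/

set_option autoImplicit false

noncomputable section

open MeasureTheory Measure Set NumberField IsDedekindDomain Matrix
open Literature.NumberTheory.Automorphic Literature.NumberTheory.Automorphic.UnitaryGroup
open Literature.NumberTheory.GaloisRepresentations
open scoped NNReal ENNReal Matrix MatrixGroups

namespace Literature.NumberTheory.Rogawski1990

variable (L : Type) [Field L] [NumberField L] [IsCMField L]

set_option maxHeartbeats 800000 in
-- statement-heavy (the ★ S0 FILE 2 ∕ S3-A binder blocks); the proof is two one-term collapses + ★ p858772 §4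
/-- **ROW (3)'s `G`-SIDE FOR A GENERIC PIECE: on the Levi stratum the `Δ`-weighted class sums of two `Ad K`-invariant, `ι_v γ_H`-left-invariant Borel functions are proportional in
the ratio of their unipotent-fibre volumes** (division-free).  Binders: the frame and measure block of ★ `classOrbitalIntegral_eq_smul_integral_prod_of_torus_regular` (any non-split
place `w ∣ v`, `c • w = w`; `H′` with `ᵗT̄₀ H′ T₀ = a • Φ₃`; ANY Haar `νG`, CANONICAL `mG`; the hyperspecial `K ≤ U(Φ₃)(L⁺_v)` by membership; Haar `κ`, `μ_N`, s-finite), ANY local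
transfer factor `T`, and the Levi element `γ_H = (diag(d′₀, d′₁), u)` of ★ S3-A (`d′₀⁻¹u − 1`, `d′₀⁻¹d′₁ − 1`, `u − d′₁` units; `G`-regularity is NOT needed for the one-term collapse).
[cite: Rogawski1990, §4.9 Prop. 4.9.1 (b) p. 55, Lemma 4.9.2 p. 56; §4.3 (4.3.1) p. 43; §3.5 Prop. 3.5.2 pp. 25–26] [cite: Kottwitz1986, §7] -/
theorem finsum_delta_mul_classOrbitalIntegral_mul_integral_eq_of_levi (H' : Matrix (Fin 3) (Fin 3) L)
    (hH' : (H'.map (IsCMField.complexConj L))ᵀ = H') (hH'd : IsUnit H'.det)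
    {v : HeightOneSpectrum (𝓞 ↥(maximalRealSubfield L))} (w : PlacesOver L v) (hw : IsCMField.complexConj L • w.1 = w.1)
    (T₀ : GL (Fin 3) (UnitaryGroup.LocalRing L v)) {a : UnitaryGroup.LocalRing L v} (ha₀ : IsUnit a)
    (h : formCongr (conjLocal L (IsCMField.complexConj L) v) T₀ (H'.map (algebraMap L (UnitaryGroup.LocalRing L v))) =
      a • (Matrix.of fun i j : Fin 3 => if i.val + j.val + 1 = 3 then (1 : L) else 0).map (algebraMap L (UnitaryGroup.LocalRing L v)))
    [MeasurableSpace ((cmDatum L 3 H').Local v)] [BorelSpace ((cmDatum L 3 H').Local v)]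
    [∀ γ : (cmDatum L 3 H').Local v, MeasurableSpace (((cmDatum L 3 H').Local v) ⧸ Subgroup.centralizer ({γ} : Set ((cmDatum L 3 H').Local v)))]
    [∀ γ : (cmDatum L 3 H').Local v, BorelSpace (((cmDatum L 3 H').Local v) ⧸ Subgroup.centralizer ({γ} : Set ((cmDatum L 3 H').Local v)))]
    (νG : Measure ((cmDatum L 3 H').Local v)) [νG.IsHaarMeasure] [νG.IsMulRightInvariant]
    {mG : OrbitalMeasureFamily ((cmDatum L 3 H').Local v)}
    (hmG : mG.IsCanonical (fun γ => IsRegularElt (γ.val : GL (Fin 3) (UnitaryGroup.LocalRing L v))) νG)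
    [MeasurableSpace ↥(unitaryGroupOfForm (conjLocal L (IsCMField.complexConj L) v) (cmLocalForm L 3 v))] [BorelSpace ↥(unitaryGroupOfForm (conjLocal L (IsCMField.complexConj L) v) (cmLocalForm L 3 v))]
    {K : Subgroup ↥(unitaryGroupOfForm (conjLocal L (IsCMField.complexConj L) v) (cmLocalForm L 3 v))}
    (hKv : ∀ g : ↥(unitaryGroupOfForm (conjLocal L (IsCMField.complexConj L) v) (cmLocalForm L 3 v)), g ∈ K ↔ g ∈ cmLocalIntegralLevel L 3 (Matrix.of fun i j : Fin 3 => if i.val + j.val + 1 = 3 then (1 : L) else 0) v)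
    (κ : Measure ↥K) [κ.IsHaarMeasure] [SFinite κ]
    (μN : Measure ↥(unipotentU (conjLocal L (IsCMField.complexConj L) v) (cmLocalForm L 3 v))) [μN.IsHaarMeasure] [SFinite μN]
    (T : LocalTransferFactor L H' v)
    {γH : ((cmDatum L 2 (Matrix.of fun i j : Fin 2 => if i.val + j.val + 1 = 2 then (1 : L) else 0)).Local v ×
      (cmDatum L 1 (Matrix.of fun i j : Fin 1 => if i.val + j.val + 1 = 1 then (1 : L) else 0)).Local v)}
    {d' : Fin 2 → (UnitaryGroup.LocalRing L v)ˣ} (hd' : glDiagonal 2 (UnitaryGroup.LocalRing L v) d' = (γH.1.val : GL (Fin 2) (UnitaryGroup.LocalRing L v)))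
    (ha : IsUnit ((((d' 0)⁻¹ * (isUnit_finGammaTwo L v γH).unit : (UnitaryGroup.LocalRing L v)ˣ) : UnitaryGroup.LocalRing L v) - 1))
    (hb : IsUnit ((((d' 0)⁻¹ * d' 1 : (UnitaryGroup.LocalRing L v)ˣ) : UnitaryGroup.LocalRing L v) - 1))
    (h12 : IsUnit (finGammaTwo L v γH - (d' 1 : UnitaryGroup.LocalRing L v)))
    {φ φ' : (cmDatum L 3 H').Local v → ℂ} (hφ : Measurable φ) (hφ' : Measurable φ')
    (hconj : ∀ (k : ↥K) (x : ↥(unitaryGroupOfForm (conjLocal L (IsCMField.complexConj L) v) (cmLocalForm L 3 v))), φ (cmDatumLocalCongr L v T₀ ha₀ h ((k : ↥(unitaryGroupOfForm (conjLocal L (IsCMField.complexConj L) v) (cmLocalForm L 3 v))) * x * (k : ↥(unitaryGroupOfForm (conjLocal L (IsCMField.complexConj L) v) (cmLocalForm L 3 v)))⁻¹)) = φ (cmDatumLocalCongr L v T₀ ha₀ h x))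
    (hleft : ∀ x : ↥(unitaryGroupOfForm (conjLocal L (IsCMField.complexConj L) v) (cmLocalForm L 3 v)), φ (cmDatumLocalCongr L v T₀ ha₀ h ((@id ↥(unitaryGroupOfForm (conjLocal L (IsCMField.complexConj L) v) (cmLocalForm L 3 v)) (endoEmbLocal L v γH)) * x)) = φ (cmDatumLocalCongr L v T₀ ha₀ h x))
    (hconj' : ∀ (k : ↥K) (x : ↥(unitaryGroupOfForm (conjLocal L (IsCMField.complexConj L) v) (cmLocalForm L 3 v))), φ' (cmDatumLocalCongr L v T₀ ha₀ h ((k : ↥(unitaryGroupOfForm (conjLocal L (IsCMField.complexConj L) v) (cmLocalForm L 3 v))) * x * (k : ↥(unitaryGroupOfForm (conjLocal L (IsCMField.complexConj L) v) (cmLocalForm L 3 v)))⁻¹)) = φ' (cmDatumLocalCongr L v T₀ ha₀ h x))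
    (hleft' : ∀ x : ↥(unitaryGroupOfForm (conjLocal L (IsCMField.complexConj L) v) (cmLocalForm L 3 v)), φ' (cmDatumLocalCongr L v T₀ ha₀ h ((@id ↥(unitaryGroupOfForm (conjLocal L (IsCMField.complexConj L) v) (cmLocalForm L 3 v)) (endoEmbLocal L v γH)) * x)) = φ' (cmDatumLocalCongr L v T₀ ha₀ h x)) :
    (∑ᶠ c : ConjClasses ((cmDatum L 3 H').Local v), T.Δ γH (Quotient.out c) * classOrbitalIntegral mG φ c) *
        ∫ n : ↥(unipotentU (conjLocal L (IsCMField.complexConj L) v) (cmLocalForm L 3 v)), φ' (cmDatumLocalCongr L v T₀ ha₀ h (n : ↥(unitaryGroupOfForm (conjLocal L (IsCMField.complexConj L) v) (cmLocalForm L 3 v)))) ∂μN =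
      (∑ᶠ c : ConjClasses ((cmDatum L 3 H').Local v), T.Δ γH (Quotient.out c) * classOrbitalIntegral mG φ' c) *
        ∫ n : ↥(unipotentU (conjLocal L (IsCMField.complexConj L) v) (cmLocalForm L 3 v)), φ (cmDatumLocalCongr L v T₀ ha₀ h (n : ↥(unitaryGroupOfForm (conjLocal L (IsCMField.complexConj L) v) (cmLocalForm L 3 v)))) ∂μN := by
  -- the torus datum `ι_v(γ_H) = diag(d′₀, u, d′₁)`, regular
  have hι := endoEmbLocal_eq_glDiagonal_of_fst_eq L v γH hd'
  have hu : (((isUnit_finGammaTwo L v γH).unit : (UnitaryGroup.LocalRing L v)ˣ) : UnitaryGroup.LocalRing L v) = finGammaTwo L v γH :=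
    (isUnit_finGammaTwo L v γH).unit_spec
  have hreg3 := isUnit_vecCons_sub_of_levi ha hb (by rw [hu]; exact h12)
  -- `t := ι_v(γ_H) ∈ T`, the frame's norm pair `γ₀ := e t`, and the one-term collapse of both class sums
  have ht := endoEmbLocal_mem_torusU_of_endoEmbLocal_eq L v γH hι
  obtain ⟨t, ht_eq⟩ : ∃ t : ↥(torusU (conjLocal L (IsCMField.complexConj L) v) (cmLocalForm L 3 v)), (t : ↥(unitaryGroupOfForm (conjLocal L (IsCMField.complexConj L) v) (cmLocalForm L 3 v))) = (@id ↥(unitaryGroupOfForm (conjLocal L (IsCMField.complexConj L) v) (cmLocalForm L 3 v)) (endoEmbLocal L v γH)) := ⟨⟨_, ht⟩, rfl⟩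
  have hd : glDiagonal 3 (UnitaryGroup.LocalRing L v) ![d' 0, (isUnit_finGammaTwo L v γH).unit, d' 1] = ((t : ↥(unitaryGroupOfForm (conjLocal L (IsCMField.complexConj L) v) (cmLocalForm L 3 v))) : GL (Fin 3) (UnitaryGroup.LocalRing L v)) := by
    rw [ht_eq]; exact hι.symm
  have h₀ : IsLocalNormPair L H' v γH (cmDatumLocalCongr L v T₀ ha₀ h (@id ↥(unitaryGroupOfForm (conjLocal L (IsCMField.complexConj L) v) (cmLocalForm L 3 v)) (endoEmbLocal L v γH))) := isLocalNormPair_cmDatumLocalCongr_endoEmbLocal L H' T₀ ha₀ h γH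
  have huniq : ∀ k : (cmDatum L 3 H').Local v, IsLocalNormPair L H' v γH k → IsConj (cmDatumLocalCongr L v T₀ ha₀ h (@id ↥(unitaryGroupOfForm (conjLocal L (IsCMField.complexConj L) v) (cmLocalForm L 3 v)) (endoEmbLocal L v γH))) k :=
    fun k hk => isConj_of_isLocalNormPair_of_isLocalNormPair_of_levi L H' hH' hH'd γH hι hreg3 h₀ hk
  rw [finsum_delta_mul_classOrbitalIntegral_eq_of_unique T mG φ γH _ huniq, finsum_delta_mul_classOrbitalIntegral_eq_of_unique T mG φ' γH _ huniq]
  -- ★ p858772 §4 at the regular split-torus class `⟦e t⟧`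
  have key := classOrbitalIntegral_mul_integral_eq_of_conj_invariant_of_left_invariant L H' hH' hH'd w hw T₀ ha₀ h νG hmG hKv κ μN t hd hreg3 ha hb
    hφ hφ' hconj (fun x => by rw [ht_eq]; exact hleft x) hconj' (fun x => by rw [ht_eq]; exact hleft' x)
  rw [ht_eq] at key
  rw [mul_assoc, key, ← mul_assoc]

end Literature.NumberTheory.Rogawski1990

end
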